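import Summits.ResolutionOfSingularities.ResolutionOfSingularities.Theorems.RadicialJungCleanModelsSufficeChartsFamily
import Summits.ResolutionOfSingularities.ResolutionOfSingularities.Theorems.RadicialJungCleanModelsSufficeNormalizeExponents
import Summits.ResolutionOfSingularities.ResolutionOfSingularities.Theorems.RadicialJungCleanModelsSufficeKummerOrderStructure
import Summits.ResolutionOfSingularities.ResolutionOfSingularities.Theorems.RadicialJungCleanModelsSufficeKummerOrderLogRegular
import Summits.ResolutionOfSingularities.ResolutionOfSingularities.Theorems.RadicialJungCleanModelsSufficePIndep
import Summits.ResolutionOfSingularities.ResolutionOfSingularities.Theorems.RadicialJungCleanModelsSufficeRootOverring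
import Summits.ResolutionOfSingularities.ResolutionOfSingularities.Theorems.RadicialJungCleanModelsSufficeKummerDescent
import Summits.ResolutionOfSingularities.ResolutionOfSingularities.Theorems.RadicialJungCleanModelsSufficeKummerNormal

/-!
# Route `RadicialJung`, crux `CleanModelsSuffice`, line `Sketch`: the Kato charts of an adapted
# model, UNCONDITIONALLY (without Kato 1994 (4.1))

Helper for the registered stub `stub_adaptedKN` of the skeleton of
`Summit.ResolutionOfSingularities.ResolutionOfSingularities.Theses.RadicialJung.CleanModelsSuffice`
(stmt-ResolutionOfSingularities-15883). The chart files `…ChartsCaseA`, `…ChartsPoint`,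
`…ChartsSections`, `…ChartsFamily` thread four ring-level hypotheses: `hNorm` (normalisation of
exponents), `hStruct` (structure of the Kummer order), `hLogReg` (its log regularity) — all three
LANDED as `stub_normalizeExponents`, `stub_kummerOrderStructure`, `stub_kummerOrderLogRegular` — and
the unfolded Theorem (4.1) of Kato 1994 (`hK4`: log regular local rings are normal), which is used
exactly once, in `isLogRegularLocal_kummerChartIntegral`, to see that the log regular Kummer order
`A[z_0, …, z_{p-1}]` is integrally closed. That special case is now a THEOREM (`kummerNormal` below:
`stub_kummerNormal` fed with `stub_kummerDescent stub_pIndep stub_rootOverring`, all landed). This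
file therefore re-derives the `hK4`-dependent chain with NO ring-level hypothesis left:

* `kummerNormal`: the Kummer order over a regular local ring is integrally closed;
* `adjoin_eq_integralClosure_of_isIntegrallyClosed` (registered companion): an integral,
  integrally closed `A[s] ⊆ L` with fraction field `L` equals `integralClosure A L`;
* `isLogRegularLocal_kummerChartIntegralKN` ← `isLogRegularLocal_kummerChartIntegral`
  (`…ChartsCaseA`);
* `AdaptedData.caseAKN`, `AdaptedData.isLocalRing_integralClosureKN` ← `caseA`,
  `isLocalRing_integralClosure` (`…ChartsPoint`);
* `AdaptedData.exists_stalkIsoKN`, `AdaptedData.isLogRegularLocal_φKN` ← `exists_stalkIso`,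
  `isLogRegularLocal_φ` (`…ChartsSections`);
* `AdaptedData.isLogRegularLocal_chartKN`, `AdaptedData.chart_compatibleKN` ←
  `isLogRegularLocal_chart`, `chart_compatible` (`…ChartsFamily`).

All definitions (`kci`, `φ`, `W`, `n`, `P`, `chart`, …) and all `hK4`-free theorems are used from
the tree unchanged, with `hNorm := stub_normalizeExponents`.
-/

noncomputable section

set_option linter.dupNamespace false -- mandated namespace of this single-conjunct summit

open CategoryTheory AlgebraicGeometry TopologicalSpace
open Literature.AlgebraicGeometry.Resolution IsLocalRing

namespace Summit.ResolutionOfSingularities.ResolutionOfSingularities.Theorems.RadicialJung.CleanModelsSuffice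

attribute [local instance] stalkAlgebra isScalarTower_stalkAlgebra

/-! ## An integrally closed order with fraction field `L` is the integral closure -/

/-- **An integral, integrally closed subalgebra `A[s] ⊆ L` with fraction field `L` is the
integral closure of `A` in `L`.** [folklore] -/
theorem adjoin_eq_integralClosure_of_isIntegrallyClosed {A L : Type} [CommRing A] [Field L] [Algebra A L]
    (s : Set L) [Algebra.IsIntegral A (Algebra.adjoin A s)] [IsIntegrallyClosed (Algebra.adjoin A s)]
    [IsFractionRing (Algebra.adjoin A s) L] : Algebra.adjoin A s = integralClosure A L := by
  apply le_antisymm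
  · intro x hx
    have h1 : IsIntegral A (⟨x, hx⟩ : Algebra.adjoin A s) := Algebra.IsIntegral.isIntegral _
    exact h1.map (Algebra.adjoin A s).val
  · intro x hx
    have h1 : IsIntegral (Algebra.adjoin A s) x := IsIntegral.tower_top hx
    obtain ⟨r, hr⟩ := (isIntegrallyClosed_iff L).mp ‹_› h1
    rw [← hr]
    exact r.2

/-! ## Kummer normality: the special case of Kato (4.1), proved -/

/-- **The Kummer order over a regular local ring is integrally closed** — UNCONDITIONAL: the landed
`stub_kummerNormal` fed with the landed descent `stub_kummerDescent stub_pIndep stub_rootOverring`.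
Let `A` be a regular local ring with fraction field `K` of characteristic `p`, `L/K` of degree `p`,
`(t, a, y)` normalised Kummer data (`a₀ = 1`, `1 ≤ a_i < p`, `t_i ≠ 0`, `y ∉ K`, `y^p = ∏ t_i^{a_i}`)
with some `t_i ∈ 𝔪_A` and those in `𝔪_A` jointly part of a minimal system of generators of `𝔪_A`;
then `A[y^j/∏ t_i^{⌊j a_i/p⌋} : j < p]` is integrally closed. This is the special case of
Kato 1994 (4.1) ("log regular ⇒ normal") that the line `Sketch` uses. [folklore] -/
theorem kummerNormal {A K L : Type} [CommRing A] [IsRegularLocalRing A] [Field K]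
    [Algebra A K] [IsFractionRing A K] [Field L] [Algebra K L] [Algebra A L] [IsScalarTower A K L]
    (p : ℕ) (hp : p.Prime) [CharP K p] (hdeg : Module.finrank K L = p) (m : ℕ)
    (t : Fin (m + 1) → A) (ht : ∀ i, t i ≠ 0) (a : Fin (m + 1) → ℕ) (ha0 : a 0 = 1)
    (ha : ∀ i, 1 ≤ a i ∧ a i < p) (y : L) (hy : y ∉ Set.range (algebraMap K L))
    (hyp : y ^ p = algebraMap A L (∏ i, t i ^ a i))
    (hSne : ∃ i, t i ∈ maximalIdeal A)
    (hsop : ∃ (d : ℕ) (tw : Fin d → A) (ι : Fin (m + 1) → Fin d),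
      Ideal.span (Set.range tw) = maximalIdeal A ∧ ringKrullDim A = (d : WithBot ℕ∞) ∧
      (∀ i, t i ∈ maximalIdeal A → tw (ι i) = t i) ∧
      (∀ i j, t i ∈ maximalIdeal A → t j ∈ maximalIdeal A → ι i = ι j → i = j)) :
    IsIntegrallyClosed (Algebra.adjoin A (Set.range fun j : Fin p =>
      y ^ (j : ℕ) / algebraMap A L (∏ i, t i ^ ((j : ℕ) * a i / p)))) :=
  stub_kummerNormal (@stub_kummerDescent @stub_pIndep @stub_rootOverring)
    p hp hdeg m t ht a ha0 ha y hy hyp hSne hsop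

/-! ## Case A at the level of the local ring -/

/-- **Case A of the Kato charts, ring level, unconditionally.** Let `A` be a regular local ring
with fraction field `K` of characteristic `p`, `L/K` of degree `p`, `(t, a, y)` normalised Kummer
data (`a₀ = 1`, `1 ≤ a_i < p`, `y ∉ K`, `y^p = ∏ t_i^{a_i}`, `t_i ≠ 0`) such that SOME `t_i` lies
in `𝔪_A` and those that do are jointly part of a minimal system of generators of `𝔪_A`. Then
`integralClosure A L` is a local ring and the Kummer chart `P_a → integralClosure A L` is log
regular in Kato's sense: the Kummer order `A[z_j]` is local and finite with fraction field `L`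
(`stub_kummerOrderStructure`), log regular (`stub_kummerOrderLogRegular`) and integrally closed
(`kummerNormal`), hence equal to `integralClosure A L`. (= `isLogRegularLocal_kummerChartIntegral`
with its three ring-level hypotheses discharged.) [folklore] -/
theorem isLogRegularLocal_kummerChartIntegralKN
    {A K L : Type} [CommRing A] [IsRegularLocalRing A] [Field K]
    [Algebra A K] [IsFractionRing A K] [Field L] [Algebra K L] [Algebra A L] [IsScalarTower A K L]
    (p : ℕ) (hp : p.Prime) [CharP K p] (hdeg : Module.finrank K L = p) (m : ℕ)
    (t : Fin (m + 1) → A) (ht : ∀ i, t i ≠ 0) (ht' : ∀ i, algebraMap A L (t i) ≠ 0)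
    (a : Fin (m + 1) → ℕ) (ha0 : a 0 = 1)
    (ha : ∀ i, 1 ≤ a i ∧ a i < p) (y : L) (hy : y ∉ Set.range (algebraMap K L)) (hy0 : y ≠ 0)
    (hyp : y ^ p = algebraMap A L (∏ i, t i ^ a i))
    (hSne : ∃ i, t i ∈ maximalIdeal A)
    (hsop : ∃ (dw : ℕ) (tw : Fin dw → A) (ι : Fin (m + 1) → Fin dw),
      Ideal.span (Set.range tw) = maximalIdeal A ∧ ringKrullDim A = (dw : WithBot ℕ∞) ∧
      (∀ i, t i ∈ maximalIdeal A → tw (ι i) = t i) ∧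
      (∀ i j, t i ∈ maximalIdeal A → t j ∈ maximalIdeal A → ι i = ι j → i = j)) :
    IsLocalRing (integralClosure A L) ∧
      LogChart.IsLogRegularLocal (kummerMonoid p a) (kummerChartIntegral p a y t hp.pos hy0 ht' hyp) := by
  classical
  haveI : CharP L p := charP_of_injective_algebraMap (algebraMap K L).injective p
  -- the non-unit indices
  set S : Finset (Fin (m + 1)) := Finset.univ.filter fun i => t i ∈ maximalIdeal A with hS_def
  have hS : ∀ i, i ∈ S ↔ t i ∈ maximalIdeal A := fun i => by simp [hS_def]
  have hSne' : S.Nonempty := by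
    obtain ⟨i, hi⟩ := hSne
    exact ⟨i, (hS i).mpr hi⟩
  -- Kummer normality of the Kummer order (the replacement of Kato (4.1))
  have hIC := kummerNormal p hp hdeg m t ht a ha0 ha y hy hyp hSne hsop
  -- regularity of `A/(t_S)` with the dimension count
  obtain ⟨dw, tw, ι, hspan, hdimA, htw, hinj⟩ := hsop
  obtain ⟨hreg, hdim⟩ :=
    isRegularLocalRing_quotient_span_image t S hS dw tw ι hspan hdimA htw hinj
  -- the Kummer order and the chart into it
  let z : Fin p → L := fun j => y ^ (j : ℕ) / algebraMap A L (∏ i, t i ^ ((j : ℕ) * a i / p))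
  let φR := kummerChartAdjoin p a y t hp hy0 ht' hyp z (fun _ => rfl)
  have hφR : ∀ c : kummerMonoid p a, ((φR (Multiplicative.ofAdd c) : Algebra.adjoin A
      (Set.range z)) : L) = y ^ ((c : Fin (m + 1) → ℤ) 0) *
        ∏ i ∈ Finset.univ.erase 0, algebraMap A L (t i) ^ ((c : Fin (m + 1) → ℤ) i) :=
    fun _ => rfl
  have hLR : LogChart.IsLogRegularLocal (kummerMonoid p a) φR :=
    stub_kummerOrderLogRegular p hp hdeg m t ht a ha0 ha y hy hyp S hS hSne' hreg hdim (kummerMonoid p a)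
      (mem_kummerMonoid_iff p a) φR hφR
  obtain ⟨-, -, hfin, hloc, hfrac⟩ :=
    stub_kummerOrderStructure p hp hdeg m t ht a ha0 ha y hy hyp z (fun _ => rfl)
  haveI := hfin
  haveI := hloc
  haveI := hfrac
  haveI : IsIntegrallyClosed (Algebra.adjoin A (Set.range z)) := hIC
  -- `A[z_j] = integralClosure A L`
  have heq : Algebra.adjoin A (Set.range z) = integralClosure A L :=
    adjoin_eq_integralClosure_of_isIntegrallyClosed _
  let e : Algebra.adjoin A (Set.range z) ≃ₐ[A] integralClosure A L :=
    Subalgebra.equivOfEq _ _ heq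
  refine ⟨e.toRingEquiv.isLocalRing, ?_⟩
  have hcomp : e.toRingEquiv.toMonoidHom.comp φR = kummerChartIntegral p a y t hp.pos hy0 ht' hyp :=
    MonoidHom.ext fun c => Subtype.ext rfl
  rw [← hcomp]
  exact (LogChart.isLogRegularLocal_comp_equiv _ _ _).mpr hLR

namespace AdaptedData

variable {p : ℕ} {V : Scheme.{0}} [IsIntegral V] {L : Type} [Field L] [Algebra V.functionField L]
variable (D : AdaptedData p V L) [CharP V.functionField p]

/-! ## Case A at a point, and the local rings `integralClosure 𝒪_{V,w} L` -/

/-- **Case A at a point** (without Kato (4.1)): if some charged section of the toroidal chart `v`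
vanishes at `w ∈ U v`, then `integralClosure 𝒪_{V,w} L` is local and the Kummer chart of `v` into
it is log regular. (= `AdaptedData.caseA` with its ring-level hypotheses discharged.) [folklore] -/
theorem caseAKN (hp : p.Prime) (hdeg : Module.finrank V.functionField L = p)
    (hVreg : Scheme.IsRegular V) (v : V) (hm : 0 < D.m v) (w : V) (hw : w ∈ D.U v)
    (hA : ∃ i, D.tw v hm w hw i ∈ IsLocalRing.maximalIdeal (V.presheaf.stalk w)) :
    IsLocalRing (integralClosure (V.presheaf.stalk w) L) ∧
      LogChart.IsLogRegularLocal (kummerMonoid p (D.a' stub_normalizeExponents hp hdeg v hm))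
        (D.kci stub_normalizeExponents hp hdeg v hm w hw) := by
  haveI : IsRegularLocalRing (V.presheaf.stalk w) := hVreg w
  obtain ⟨hy', ha'0, ha', -, -, -⟩ := D.normalized_spec stub_normalizeExponents hp hdeg v hm
  obtain ⟨dw, tW, ι, hspan, hdim, htW, hinj⟩ := D.jointSop v w hw
  exact isLogRegularLocal_kummerChartIntegralKN p hp hdeg (D.m v - 1)
    (D.tw v hm w hw) (D.tw_ne_zero hp v hm w hw) (D.algebraMap_tw_ne_zero hp v hm w hw)
    (D.a' stub_normalizeExponents hp hdeg v hm) ha'0 ha' (D.y' stub_normalizeExponents hp hdeg v hm) hy'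
    (D.y'_ne_zero stub_normalizeExponents hp hdeg v hm)
    (D.y'_pow_eq_algebraMap_germ stub_normalizeExponents hp hdeg v hm w hw) hA
    ⟨dw, tW, ι ∘ D.cidx v hm, hspan, hdim, fun i hi => htW _ hi,
      fun i j hi hj h => D.cidx_injective v hm (hinj _ _ hi hj h)⟩

include D in
/-- **`integralClosure 𝒪_{V,w} L` is a local ring at every point `w`** (Case A for `w`'s own
chart at a toroidal `w`; the regular order `𝒪_{V,w}[T]/(T^p - u₀)` at a regular-type `w`).
(= `AdaptedData.isLocalRing_integralClosure`, hypotheses discharged.) [folklore] -/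
theorem isLocalRing_integralClosureKN (hp : p.Prime) (hdeg : Module.finrank V.functionField L = p)
    (hVreg : Scheme.IsRegular V) (w : V) :
    IsLocalRing (integralClosure (V.presheaf.stalk w) L) := by
  haveI : IsRegularLocalRing (V.presheaf.stalk w) := hVreg w
  rcases (D.pointwise w).2.2.2.2.2.2 with ⟨hm, -⟩ | ⟨-, u₀, -, hg, hu⟩
  · refine (caseAKN D hp hdeg hVreg w hm w (D.hU w) ⟨0, ?_⟩).1
    rw [tw, D.germ_sC]
    exact D.tC_mem w hm 0
  · haveI : CharP (V.presheaf.stalk w) p :=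
      RingHom.charP (algebraMap (V.presheaf.stalk w) V.functionField) (IsFractionRing.injective _ _) p
    haveI : CharP L p := charP_of_injective_ringHom (algebraMap V.functionField L).injective p
    haveI : FiniteDimensional V.functionField L :=
      Module.finite_of_finrank_pos (by rw [hdeg]; exact hp.pos)
    have hyp : D.y w ^ p = algebraMap (V.presheaf.stalk w) L u₀ := by
      rw [← (D.pointwise w).2.1, hg, ← IsScalarTower.algebraMap_apply]
    rcases hu with hwound | ⟨x, hx1, hx2⟩
    · haveI := CleanResolves.isRegularLocalRing_integralClosure_of_wound (K := V.functionField) hp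
        hdeg u₀ (D.y w) (D.pointwise w).1 hyp hwound
      infer_instance
    · haveI := CleanResolves.isRegularLocalRing_integralClosure_of_transversal (K := V.functionField)
        hp hdeg u₀ (D.y w) (D.pointwise w).1 hyp x hx1 (fun h => hx2 (Ideal.mem_sup_left h))
      infer_instance

/-! ## The stalk isomorphism and the log regularity of the toroidal chart -/

include D in
/-- **The stalk isomorphism** `𝒪_{V^L,x} ≃ integralClosure 𝒪_{V,ιx} L` compatible with values in
`L` (it exists because the integral closure is local, `isLocalRing_integralClosureKN`).
(= `AdaptedData.exists_stalkIso`, hypotheses discharged.) [folklore] -/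
theorem exists_stalkIsoKN (hp : p.Prime) (hdeg : Module.finrank V.functionField L = p)
    (hVreg : Scheme.IsRegular V) (x : normalizationIn V L) :
    ∃ e : (normalizationIn V L).presheaf.stalk x ≃+*
        integralClosure (V.presheaf.stalk (normalizationInι V L x)) L,
      ∀ z, ((e z : integralClosure (V.presheaf.stalk (normalizationInι V L x)) L) : L) =
        stalkToField V L x z := by
  haveI := isLocalRing_integralClosureKN D hp hdeg hVreg (normalizationInι V L x)
  exact exists_ringEquiv_stalk_integralClosure V L x

/-- **The toroidal Kato chart is log regular at every point of its domain** (Case A: transport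
the log regularity of `kci v (ι x)` along the stalk isomorphism; Case B: the chart is by units
at `x` and `𝒪_{V^L,x}` is regular). (= `AdaptedData.isLogRegularLocal_φ`, hypotheses discharged.)
[folklore] -/
theorem isLogRegularLocal_φKN (hp : p.Prime) (hdeg : Module.finrank V.functionField L = p)
    (hVreg : Scheme.IsRegular V) (v : V) (hm : 0 < D.m v) (x : normalizationIn V L)
    (hx : x ∈ normalizationInι V L ⁻¹ᵁ D.U' v) :
    LogChart.IsLogRegularLocal (kummerMonoid p (D.a' stub_normalizeExponents hp hdeg v hm))
      (((normalizationIn V L).presheaf.germ (normalizationInι V L ⁻¹ᵁ D.U' v) x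
        hx).hom.toMonoidHom.comp (D.φ stub_normalizeExponents hp hdeg v hm)) := by
  obtain ⟨e, he⟩ := exists_stalkIsoKN D hp hdeg hVreg x
  have hcomp := D.comp_germ_φ_eq_kci stub_normalizeExponents hp hdeg v hm x hx e he
  by_cases hA : ∃ i, D.tw v hm (normalizationInι V L x) (D.U'_le v hx) i ∈
      IsLocalRing.maximalIdeal (V.presheaf.stalk (normalizationInι V L x))
  · have h := (caseAKN D hp hdeg hVreg v hm _ (D.U'_le v hx) hA).2
    rw [← hcomp] at h
    exact (LogChart.isLogRegularLocal_comp_equiv _ _ e).mp h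
  · push Not at hA
    have hunit : ∀ c : kummerMonoid p (D.a' stub_normalizeExponents hp hdeg v hm),
        IsUnit ((((normalizationIn V L).presheaf.germ (normalizationInι V L ⁻¹ᵁ D.U' v) x
          hx).hom.toMonoidHom.comp (D.φ stub_normalizeExponents hp hdeg v hm))
          (Multiplicative.ofAdd c)) := by
      intro c
      have h1 := D.isUnit_kci stub_normalizeExponents hp hdeg v hm _ (D.U'_le v hx) hA
        (Multiplicative.ofAdd c)
      rw [← D.stalkIso_germ_φ stub_normalizeExponents hp hdeg v hm x hx e he] at h1
      exact (isUnit_map_iff e _).mp h1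
    rw [LogChart.isLogRegularLocal_iff_of_forall_isUnit _ (span_kummerMonoid_eq_top p _) _ hunit]
    exact D.isRegularLocalRing_stalk_of_m_eq_zero hp hdeg hVreg x
      (D.m_eq_zero_of_forall_not_mem v hm _ (D.U'_le v hx) hA)

/-! ## The four chart properties: log regularity and compatibility -/

/-- **Every chart is log regular at every point of its domain.**
(= `AdaptedData.isLogRegularLocal_chart`, hypotheses discharged.) [folklore] -/
theorem isLogRegularLocal_chartKN (hp : p.Prime) (hdeg : Module.finrank V.functionField L = p)
    (hVreg : Scheme.IsRegular V) (i : {v : V // 0 < D.m v} ⊕ V) (x : normalizationIn V L)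
    (hx : x ∈ D.W i) :
    LogChart.IsLogRegularLocal (D.P stub_normalizeExponents hp hdeg i)
      (((normalizationIn V L).presheaf.germ (D.W i) x hx).hom.toMonoidHom.comp
        (D.chart stub_normalizeExponents hp hdeg i)) := by
  rcases i with ⟨v, hm⟩ | v
  · exact isLogRegularLocal_φKN D hp hdeg hVreg v hm x hx
  · obtain ⟨hv, hx'⟩ := D.of_mem_W_inr hx
    exact D.isLogRegularLocal_one hp hdeg hVreg v hv x (D.U'_le v hx') _ hx

/-- **Any two charts are compatible at a common point**: every value of the one is a unit
multiple at `x` of some value of the other. (= `AdaptedData.chart_compatible`, hypotheses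
discharged.) [folklore] -/
theorem chart_compatibleKN (hp : p.Prime) (hdeg : Module.finrank V.functionField L = p)
    (hVreg : Scheme.IsRegular V) (i j : {v : V // 0 < D.m v} ⊕ V) (x : normalizationIn V L)
    (hi : x ∈ D.W i) (hj : x ∈ D.W j) (c : D.P stub_normalizeExponents hp hdeg i) :
    ∃ c' : D.P stub_normalizeExponents hp hdeg j,
      Associated ((normalizationIn V L).presheaf.germ (D.W i) x hi
          (D.chart stub_normalizeExponents hp hdeg i (Multiplicative.ofAdd c)))
        ((normalizationIn V L).presheaf.germ (D.W j) x hj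
          (D.chart stub_normalizeExponents hp hdeg j (Multiplicative.ofAdd c'))) := by
  -- the value `1` of the chart `j`
  have hone : (normalizationIn V L).presheaf.germ (D.W j) x hj
      (D.chart stub_normalizeExponents hp hdeg j
        (Multiplicative.ofAdd (0 : D.P stub_normalizeExponents hp hdeg j))) = 1 := by
    rw [ofAdd_zero, map_one, map_one]
  rcases i with ⟨v, hm⟩ | v
  · by_cases hunit : IsUnit ((normalizationIn V L).presheaf.germ (D.W (Sum.inl ⟨v, hm⟩)) x hi
        (D.chart stub_normalizeExponents hp hdeg (Sum.inl ⟨v, hm⟩) (Multiplicative.ofAdd c)))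
    · exact ⟨0, by rw [hone]; exact associated_one_iff_isUnit.mpr hunit⟩
    · -- not a unit: a charged section of `v` vanishes at `w = ι x`
      obtain ⟨e, he⟩ := exists_stalkIsoKN D hp hdeg hVreg x
      have hA : ∃ i₁, D.tw v hm (normalizationInι V L x) (D.U'_le v hi) i₁ ∈
          IsLocalRing.maximalIdeal (V.presheaf.stalk (normalizationInι V L x)) := by
        by_contra hB
        push Not at hB
        have h1 := D.isUnit_kci stub_normalizeExponents hp hdeg v hm _ (D.U'_le v hi) hB
          (Multiplicative.ofAdd c)
        rw [← D.stalkIso_germ_φ stub_normalizeExponents hp hdeg v hm x hi e he] at h1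
        exact hunit ((isUnit_map_iff e _).mp h1)
      obtain ⟨i₁, hi₁⟩ := hA
      rcases j with ⟨v', hm'⟩ | v'
      · -- two toroidal charts: `exists_associated_kci` through the stalk isomorphism
        obtain ⟨c', hc'⟩ := D.exists_associated_kci stub_normalizeExponents hp hdeg hVreg v hm v' hm'
          _ (D.U'_le v hi) (D.U'_le v' hj) c
        refine ⟨c', ?_⟩
        rw [← D.stalkIso_germ_φ stub_normalizeExponents hp hdeg v hm x hi e he,
          ← D.stalkIso_germ_φ stub_normalizeExponents hp hdeg v' hm' x hj e he] at hc'
        have h := hc'.map e.symm.toMonoidHom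
        have h' : Associated
            ((normalizationIn V L).presheaf.germ (normalizationInι V L ⁻¹ᵁ D.U' v) x hi
              (D.φ stub_normalizeExponents hp hdeg v hm (Multiplicative.ofAdd c)))
            ((normalizationIn V L).presheaf.germ (normalizationInι V L ⁻¹ᵁ D.U' v') x hj
              (D.φ stub_normalizeExponents hp hdeg v' hm' (Multiplicative.ofAdd c'))) := by
          simpa using h
        exact h'
      · -- `j` of the second kind: `v'` is of regular type, contradicting the charged `i₁`
        exfalso
        obtain ⟨hv', hj'⟩ := D.of_mem_W_inr hj
        obtain ⟨μ, -, hμ⟩ := D.overlap v v' _ (D.U'_le v hi) (D.U'_le v' hj')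
        obtain ⟨i'', -, hiff, -⟩ := hμ (D.cidx v hm i₁) hi₁
        have h1 : ((D.cidx v hm i₁ : Fin (D.r v)) : ℕ) < D.m v := by
          have h0 := i₁.2; rw [AdaptedData.coe_cidx]; omega
        have h2 := hiff.mp h1
        omega
  · refine ⟨0, ?_⟩
    rw [hone]
    change Associated ((normalizationIn V L).presheaf.germ (D.W (Sum.inr v)) x hi
      ((1 : Multiplicative (D.P stub_normalizeExponents hp hdeg (Sum.inr v)) →* _)
        (Multiplicative.ofAdd c))) 1
    rw [MonoidHom.one_apply, map_one]

end AdaptedData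

end Summit.ResolutionOfSingularities.ResolutionOfSingularities.Theorems.RadicialJung.CleanModelsSuffice

end
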